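import Summits.ResolutionOfSingularities.ResolutionOfSingularities.Theorems.FrobeniusLadderFRationalResolutionChartAlgebraOrthantPoints
import Summits.ResolutionOfSingularities.ResolutionOfSingularities.Theorems.FrobeniusLadderFRationalResolutionAdaptedBasisOrthant
import Summits.ResolutionOfSingularities.ResolutionOfSingularities.Theorems.FrobeniusLadderFRationalResolutionBaseChartAlgebra
import Summits.ResolutionOfSingularities.ResolutionOfSingularities.Theorems.FrobeniusLadderFRationalResolutionConeNormalForm
import Summits.ResolutionOfSingularities.ResolutionOfSingularities.Theorems.FrobeniusLadderFRationalResolutionVertexChartMonoid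
import HarnessLib

/-!
# Crux `FrobeniusLadder.FRationalResolution` (stmt-ResolutionOfSingularities-15317), line `redirect`,
# stub `stub_diagonalizableQuotientResolution` — **RAY REGULARITY: off the fixed stratum a cone chart in normal form
# is regular** (design C3, entry (E-a) of memo MEMO-15317-leafhand2-g11: the «⇒» half of the pointwise description
# «`¬ regular A_𝔮 ↔ I(𝔭, φ) ⊆ 𝔮`» of the singular locus of the base chart, from log regularity alone)

For an fs chart `φ : P → A` whose monoid is a cone in normal form `P = ℤF_𝔭 + {m u + l e : l ≥ 0, a l ≤ d m}` (`d > 0`)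
and a prime `𝔮` at which `φ` is Kato-log-regular and SOME monomial `φ(p)`, `p ∈ P ∖ ℤF_𝔭`, is a unit: `A_𝔮` is a
regular local ring. Proof: `A_𝔮` is a local ring of `A[φ(p)⁻¹]`, a chart algebra for the localised monoid `P⟨−p⟩`
(`…ChartAlgebraOrthantPoints.isRegularLocalRing_localization_of_isOrthantLike_awayMonoid`, Kato (10.3)), and
`P⟨−p⟩` is ORTHANT-LIKE (`…AdaptedBasisOrthant.exists_isOrthantLike_of_mem_iff`): it is `ℤF_𝔭 ⊕ ℤu ⊕ ℕe` if `p` lies on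
the ray of `u`, all of `ℤⁿ` if `p` is interior, and the half-lattice `{a l ≤ d m} = ℤF_𝔭 ⊕ ℤv' ⊕ ℕx'` if `p` lies on the
ray `a l = d m` — the adapted pair `(v', x')` coming from Bézout (`…ConeNormalForm.exists_primitive`).

* `isRegularLocalRing_of_monomial_unit` — the statement above.

Honest label: generic log geometry toward ONE leaf stub (no stub, crux or summit closed). No definitions, no named facts,
no sorry. [cite: Kato1994, (9.8), (10.1), (10.3)] [cite: KempfEtAl1973, Ch. I §1–§2]
-/

noncomputable section

-- single-problem summit: the doubled namespace component is forced
set_option linter.dupNamespace false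

open IsLocalRing Literature.AlgebraicGeometry.Resolution Literature.AlgebraicGeometry.Resolution.LogChart
  Literature.AlgebraicGeometry.Resolution.LogRefinedChart
open Summit.ResolutionOfSingularities.ResolutionOfSingularities.Theorems.FRationalResolution
open Summit.ResolutionOfSingularities.ResolutionOfSingularities.Theorems.FRationalResolution.ChartAlgebraOrthantPoints
open Summit.ResolutionOfSingularities.ResolutionOfSingularities.Theorems.FRationalResolution.AdaptedBasisOrthant
open Summit.ResolutionOfSingularities.ResolutionOfSingularities.Theorems.FRationalResolution.VertexChartMonoid

namespace Summit.ResolutionOfSingularities.ResolutionOfSingularities.Theorems.FRationalResolution.RayRegular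

universe u

variable {A : Type u} [CommRing A] [IsNoetherianRing A] {n : ℕ} {P : AddSubmonoid (Fin n → ℤ)}
  {φ : Multiplicative P →* A} {𝔭 : Ideal A} [𝔭.IsPrime] {u e : Fin n → ℤ} {a d : ℕ}

set_option maxHeartbeats 800000 in
/-- **Ray regularity.** See the module docstring. [cite: Kato1994, (9.8), (10.1), (10.3)] -/
theorem isRegularLocalRing_of_monomial_unit (hP : P.FG)
    (hsat : ∀ (w : Fin n → ℤ) (k : ℕ), 0 < k → k • w ∈ P → w ∈ P)
    (hspanP : Submodule.span ℤ (P : Set (Fin n → ℤ)) = ⊤) (hd : 0 < d)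
    (hQ : ∀ w, w ∈ P ↔ ∃ g ∈ Submodule.span ℤ (faceMonoid P φ 𝔭 : Set (Fin n → ℤ)), ∃ m l : ℤ,
      0 ≤ l ∧ (a : ℤ) * l ≤ (d : ℤ) * m ∧ w = g + m • u + l • e)
    (hind : ∀ g ∈ Submodule.span ℤ (faceMonoid P φ 𝔭 : Set (Fin n → ℤ)), ∀ m l : ℤ,
      g + m • u + l • e = 0 → m = 0 ∧ l = 0)
    (hspan : ∀ w : Fin n → ℤ, ∃ g ∈ Submodule.span ℤ (faceMonoid P φ 𝔭 : Set (Fin n → ℤ)),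
      ∃ m l : ℤ, w = g + m • u + l • e)
    (𝔮 : Ideal A) [𝔮.IsPrime] (hreg𝔮 : IsLogRegularAt P φ 𝔮) (p : P)
    (hpL : (p : Fin n → ℤ) ∉ Submodule.span ℤ (faceMonoid P φ 𝔭 : Set (Fin n → ℤ)))
    (hp𝔮 : φ (Multiplicative.ofAdd p) ∉ 𝔮) :
    IsRegularLocalRing (Localization.AtPrime 𝔮) := by
  classical
  obtain ⟨g₀, hg₀, m₀, l₀, hl₀, hml₀, hp⟩ := (hQ p).1 p.2
  have hne : ¬ (m₀ = 0 ∧ l₀ = 0) := by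
    rintro ⟨rfl, rfl⟩
    apply hpL
    rw [hp]
    simpa using hg₀
  have hdpos : (0 : ℤ) < d := by exact_mod_cast hd
  -- membership in the localised monoid, unfolded
  have hmem : ∀ w, w ∈ awayMonoid P p ↔ ∃ k : ℕ, w + (k : ℤ) • (g₀ + m₀ • u + l₀ • e) ∈ P := by
    intro w
    rw [mem_awayMonoid_iff, hp]
    simp only [natCast_zsmul]
  -- the algebra of the coordinates
  have hsub : ∀ (g' : Fin n → ℤ) (m' l' : ℤ) (k : ℕ) (w : Fin n → ℤ),
      w + (k : ℤ) • (g₀ + m₀ • u + l₀ • e) = g' + m' • u + l' • e →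
        w = (g' - (k : ℤ) • g₀) + (m' - k * m₀) • u + (l' - k * l₀) • e := by
    intro g' m' l' k w h
    have h' : w = (g' + m' • u + l' • e) - (k : ℤ) • (g₀ + m₀ • u + l₀ • e) := by
      rw [← h, add_sub_cancel_right]
    rw [h']
    module
  have hadd : ∀ (g : Fin n → ℤ) (m l : ℤ) (k : ℕ),
      (g + m • u + l • e) + (k : ℤ) • (g₀ + m₀ • u + l₀ • e) =
        (g + (k : ℤ) • g₀) + (m + k * m₀) • u + (l + k * l₀) • e := by
    intro g m l k
    module
  -- the localised monoid is orthant-like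
  have hOL : ∃ (b : Module.Basis (Fin n) ℤ (Fin n → ℤ)) (I : Finset (Fin n)), IsOrthantLike b I (awayMonoid P p) := by
    rcases eq_or_ne l₀ 0 with hl₀0 | hl₀0
    · -- (i) `p` on the ray of `u`: `P⟨−p⟩ = ℤF ⊕ ℤu ⊕ ℕe`
      subst hl₀0
      have hm₀ : 1 ≤ m₀ := by
        have h1 : (d : ℤ) * 0 ≤ (d : ℤ) * m₀ := by simpa using hml₀
        have h2 : 0 ≤ m₀ := le_of_mul_le_mul_left h1 hdpos
        rcases h2.lt_or_eq with h3 | h3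
        · omega
        · exact absurd ⟨h3.symm, rfl⟩ hne
      refine exists_isOrthantLike_of_mem_iff hind hspan {1} fun w => ⟨fun hw => ?_, ?_⟩
      · obtain ⟨k, hk⟩ := (hmem w).1 hw
        obtain ⟨g', hg', m', l', hl', -, hEq⟩ := (hQ _).1 hk
        refine ⟨g' - (k : ℤ) • g₀, Submodule.sub_mem _ hg' (Submodule.smul_mem _ _ hg₀), m' - k * m₀,
          l' - k * 0, by simp, fun _ => by simpa using hl', hsub g' m' l' k w hEq⟩
      · rintro ⟨g, hg, m, l, -, hl, rfl⟩
        have hl' : 0 ≤ l := hl (by simp)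
        set K : ℕ := ((a : ℤ) * l - (d : ℤ) * m).toNat with hKdef
        have hK : (a : ℤ) * l - (d : ℤ) * m ≤ (K : ℤ) := by rw [hKdef]; exact Int.self_le_toNat _
        have hK0 : (0 : ℤ) ≤ K := by positivity
        refine (hmem _).2 ⟨K, ?_⟩
        rw [hadd]
        refine (hQ _).2 ⟨g + (K : ℤ) • g₀, Submodule.add_mem _ hg (Submodule.smul_mem _ _ hg₀), m + K * m₀,
          l + K * 0, by simpa using hl', ?_, rfl⟩
        have h1 : (K : ℤ) * 1 ≤ (K : ℤ) * ((d : ℤ) * m₀) := by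
          apply mul_le_mul_of_nonneg_left _ hK0
          nlinarith
        nlinarith
    · have hl₀pos : 0 < l₀ := lt_of_le_of_ne hl₀ (Ne.symm hl₀0)
      rcases hml₀.lt_or_eq with hlt | heq
      · -- (ii) `p` interior: `P⟨−p⟩ = ℤⁿ`
        have hδ : 1 ≤ (d : ℤ) * m₀ - (a : ℤ) * l₀ := by omega
        refine exists_isOrthantLike_of_mem_iff hind hspan ∅ fun w => ⟨fun _ => ?_, ?_⟩
        · obtain ⟨g, hg, m, l, rfl⟩ := hspan w
          exact ⟨g, hg, m, l, by simp, by simp, rfl⟩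
        · rintro ⟨g, hg, m, l, -, -, rfl⟩
          set K : ℕ := (-l).toNat + ((a : ℤ) * l - (d : ℤ) * m).toNat with hKdef
          have hK1 : -l ≤ (K : ℤ) := by
            rw [hKdef, Nat.cast_add]; exact (Int.self_le_toNat _).trans (by simp)
          have hK2 : (a : ℤ) * l - (d : ℤ) * m ≤ (K : ℤ) := by
            rw [hKdef, Nat.cast_add]
            have := Int.self_le_toNat ((a : ℤ) * l - (d : ℤ) * m)
            have h0 : (0 : ℤ) ≤ ((-l).toNat : ℤ) := by positivity
            linarith
          have hK0 : (0 : ℤ) ≤ K := by positivity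
          refine (hmem _).2 ⟨K, ?_⟩
          rw [hadd]
          refine (hQ _).2 ⟨g + (K : ℤ) • g₀, Submodule.add_mem _ hg (Submodule.smul_mem _ _ hg₀), m + K * m₀,
            l + K * l₀, ?_, ?_, rfl⟩
          · have h1 : (K : ℤ) * 1 ≤ (K : ℤ) * l₀ := mul_le_mul_of_nonneg_left (by omega) hK0
            linarith
          · have h1 : (K : ℤ) * 1 ≤ (K : ℤ) * ((d : ℤ) * m₀ - (a : ℤ) * l₀) := mul_le_mul_of_nonneg_left hδ hK0
            nlinarith
      · -- (iii) `p` on the ray `a l = d m`: `P⟨−p⟩ = {a l ≤ d m} = ℤF ⊕ ℤv' ⊕ ℕx'` (Bézout)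
        have hc0 : (![(a : ℤ), (d : ℤ)] : Fin 2 → ℤ) ≠ 0 := by
          intro h0
          have := congrFun h0 1
          simp at this
          omega
        obtain ⟨γ, u₁, e', hγ, hγu, hdet⟩ := ConeNormalForm.exists_primitive hc0
        have ha' : (a : ℤ) = (γ : ℤ) * u₁ 0 := by
          have := congrFun hγu 0; simpa using this
        have hd' : (d : ℤ) = (γ : ℤ) * u₁ 1 := by
          have := congrFun hγu 1; simpa using this
        have hγpos : (0 : ℤ) < γ := by exact_mod_cast hγ
        -- the adapted pair
        set a' := u₁ 0 with ha'def
        set d' := u₁ 1 with hd'def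
        set σ := -(e' 0) with hσdef
        set τ := -(e' 1) with hτdef
        have hbez : d' * σ - a' * τ = 1 := by rw [hσdef, hτdef]; linear_combination hdet
        set v' : Fin n → ℤ := a' • u + d' • e with hv'def
        set x' : Fin n → ℤ := σ • u + τ • e with hx'def
        -- change of coordinates
        have hcoord : ∀ (g : Fin n → ℤ) (m l : ℤ),
            g + m • u + l • e = g + (-m * τ + l * σ) • v' + (m * d' - l * a') • x' := by
          intro g m l
          have hm : m = (-m * τ + l * σ) * a' + (m * d' - l * a') * σ := by linear_combination -m * hbez
          have hl : l = (-m * τ + l * σ) * d' + (m * d' - l * a') * τ := by linear_combination -l * hbez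
          rw [hv'def, hx'def]
          conv_lhs => rw [hm, hl]
          module
        have hcoord' : ∀ (g : Fin n → ℤ) (M N : ℤ),
            g + M • v' + N • x' = g + (M * a' + N * σ) • u + (M * d' + N * τ) • e := by
          intro g M N
          rw [hv'def, hx'def]
          module
        have hind' : ∀ g ∈ Submodule.span ℤ (faceMonoid P φ 𝔭 : Set (Fin n → ℤ)), ∀ M N : ℤ,
            g + M • v' + N • x' = 0 → M = 0 ∧ N = 0 := by
          intro g hg M N h0
          rw [hcoord'] at h0
          obtain ⟨h1, h2⟩ := hind g hg _ _ h0
          constructor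
          · linear_combination σ * h2 - τ * h1 - M * hbez
          · linear_combination d' * h1 - a' * h2 - N * hbez
        have hspan' : ∀ w : Fin n → ℤ, ∃ g ∈ Submodule.span ℤ (faceMonoid P φ 𝔭 : Set (Fin n → ℤ)),
            ∃ M N : ℤ, w = g + M • v' + N • x' := by
          intro w
          obtain ⟨g, hg, m, l, rfl⟩ := hspan w
          exact ⟨g, hg, _, _, hcoord g m l⟩
        -- the ray condition and the half-plane in the new coordinates
        have hray : a' * l₀ = d' * m₀ := by
          have h1 : (γ : ℤ) * (a' * l₀) = (γ : ℤ) * (d' * m₀) := by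
            rw [← mul_assoc, ← mul_assoc, ← ha', ← hd']; exact heq
          exact mul_left_cancel₀ hγpos.ne' h1
        have hhalf : ∀ m l : ℤ, (a : ℤ) * l ≤ (d : ℤ) * m ↔ 0 ≤ m * d' - l * a' := by
          intro m l
          rw [ha', hd', mul_assoc, mul_assoc]
          constructor
          · intro h; have := le_of_mul_le_mul_left h hγpos; linarith
          · intro h; apply mul_le_mul_of_nonneg_left _ hγpos.le; linarith
        refine exists_isOrthantLike_of_mem_iff hind' hspan' {1} fun w => ⟨fun hw => ?_, ?_⟩
        · obtain ⟨k, hk⟩ := (hmem w).1 hw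
          obtain ⟨g', hg', m', l', -, hml', hEq⟩ := (hQ _).1 hk
          have hw' := hsub g' m' l' k w hEq
          refine ⟨g' - (k : ℤ) • g₀, Submodule.sub_mem _ hg' (Submodule.smul_mem _ _ hg₀), _, _, by simp,
            fun _ => ?_, by rw [hw', hcoord]⟩
          have h1 := (hhalf m' l').1 hml'
          have h2 : (m' - k * m₀) * d' - (l' - k * l₀) * a' = m' * d' - l' * a' := by
            linear_combination (k : ℤ) * hray
          rw [h2]; exact h1
        · rintro ⟨g, hg, M, N, -, hN, rfl⟩
          have hN' : 0 ≤ N := hN (by simp)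
          rw [hcoord']
          set m : ℤ := M * a' + N * σ with hmdef
          set l : ℤ := M * d' + N * τ with hldef
          have hml : (a : ℤ) * l ≤ (d : ℤ) * m := by
            rw [hhalf]
            have : m * d' - l * a' = N := by rw [hmdef, hldef]; linear_combination N * hbez
            rw [this]; exact hN'
          set K : ℕ := (-l).toNat with hKdef
          have hK : -l ≤ (K : ℤ) := by rw [hKdef]; exact Int.self_le_toNat _
          have hK0 : (0 : ℤ) ≤ K := by positivity
          refine (hmem _).2 ⟨K, ?_⟩
          rw [hadd]
          refine (hQ _).2 ⟨g + (K : ℤ) • g₀, Submodule.add_mem _ hg (Submodule.smul_mem _ _ hg₀), m + K * m₀,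
            l + K * l₀, ?_, ?_, rfl⟩
          · have h1 : (K : ℤ) * 1 ≤ (K : ℤ) * l₀ := mul_le_mul_of_nonneg_left (by omega) hK0
            linarith
          · have h2 : (d : ℤ) * (m + K * m₀) - (a : ℤ) * (l + K * l₀) = (d : ℤ) * m - (a : ℤ) * l := by
              linear_combination -(K : ℤ) * heq
            linarith
  obtain ⟨b, I, hOL⟩ := hOL
  have hreg' : IsLogRegularAt P φ (𝔮.comap (algebraMap A A)) := by
    have key : ∀ (J : Ideal A) [J.IsPrime], J = 𝔮 → IsLogRegularAt P φ J := by
      rintro J _ rfl; exact hreg𝔮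
    exact key _ (Ideal.ext fun t => by rw [Ideal.mem_comap]; exact Iff.rfl)
  exact isRegularLocalRing_localization_of_isOrthantLike_awayMonoid hP hsat hspanP (le_refl P)
    BaseChartAlgebra.self_chi BaseChartAlgebra.self_adjoin_eq_top BaseChartAlgebra.self_fieldExtension
    BaseChartAlgebra.self_denominators 𝔮 hreg' p hp𝔮 hOL

end Summit.ResolutionOfSingularities.ResolutionOfSingularities.Theorems.FRationalResolution.RayRegular

end
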